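import Summits.CriticalPhenomena.PercolationContinuityZ3.Theorems.PercNearOneGluingNoHeavyLowerTailFrontierDecRowsRow36ThreeOneCutA
import Summits.CriticalPhenomena.PercolationContinuityZ3.Theorems.PercNearOneGluingNoHeavyLowerTailFrontierDecRowsRow36ThreeOneCutC
import Summits.CriticalPhenomena.PercolationContinuityZ3.Theorems.PercNearOneGluingNoHeavyLowerTailGroupThreePointLBRows
import HarnessLib

/-!
# Row 36 across every `3 | 1` cut vertex (route `PercNearOneGluingNoHeavy`, supports-only; prim-l12-p6 g15)

Frontier dec row 36 is `E₃(D[a|b], D[a|c], D[b|y]) ≥ 0` (the path `c – a – b – y`); its stabiliser is the swap `(a b)(c y)`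
(`sahiE3_row36_swap`).  The hub case `a` (`…Row36ThreeOneCutA`) and the leaf case `c` (`…Row36ThreeOneCutC`) therefore give the
other hub `b` and the other leaf `y`:  for every cut vertex `h` isolating ONE terminal `t` of row 36 from the other three,
row 36 at the placement with `t ↦ h` implies row 36 at `(a,b,c,y)`.  Together with `sahiE3_row36_nonneg_of_cutVertex`
(`…Row36CutVertex`, the `{a,c} | {b,y}` cut, unconditional) this leaves, among cut vertices separating the terminals of row 36,
only the splits `{a,b} | {c,y}` and `{a,y} | {b,c}` (exact rational certificates exist, memo
`run/shared/lean/prim/prim-l12/FROM-prim-l12-p6-g15-ROW44-CUT-VERTICES.md` §7; not yet replayed in Lean).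
No definitions, no named facts, no sorries.
-/

noncomputable section

namespace Summit.CriticalPhenomena.PercolationContinuityZ3.Theorems.FrontierDecRows

open MeasureTheory CovTransferCert E3GroupSepCert
open Literature.Probability.Percolation Literature.Probability.LatticeModels

variable {n : ℕ}

/-- Row 36 is invariant under the swap `(a b)(c y)`. [this work] -/
theorem sahiE3_row36_swap (μ : Measure (BondConfig (Fin n))) (a b c y : Fin n) :
    sahiE3 μ (connEvent (row 36 n (b, a, y, c)).1) (connEvent (row 36 n (b, a, y, c)).2.1) (connEvent (row 36 n (b, a, y, c)).2.2) =
      sahiE3 μ (connEvent (row 36 n (a, b, c, y)).1) (connEvent (row 36 n (a, b, c, y)).2.1)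
        (connEvent (row 36 n (a, b, c, y)).2.2) := by
  have h1 : row 36 n (b, a, y, c) = (sep [b] [a], sep [b] [y], sep [a] [c]) := rfl
  have h2 : row 36 n (a, b, c, y) = (sep [a] [b], sep [a] [c], sep [b] [y]) := rfl
  simp only [h1, h2]
  rw [connEvent_sep_comm [b] [a], sahiE3_comm₂₃]

/-- **Lone hub `b`** (`{a,c,y} | {b}`): row 36 at `(a,h,c,y)` ⟹ row 36 at `(a,b,c,y)`. [this work] -/
theorem sahiE3_row36_nonneg_of_threeOneCut_b (w : Sym2 (Fin n) → unitInterval) (a b c y h : Fin n) (side : Fin n → Bool)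
    (ha : side a = true) (hc : side c = true) (hy : side y = true) (hb : side b = false)
    (hw : ∀ u v : Fin n, u ≠ h → v ≠ h → side u ≠ side v → w s(u, v) = 0)
    (h36 : 0 ≤ sahiE3 (prodBernoulli w) (connEvent (row 36 n (a, h, c, y)).1) (connEvent (row 36 n (a, h, c, y)).2.1)
      (connEvent (row 36 n (a, h, c, y)).2.2)) :
    0 ≤ sahiE3 (prodBernoulli w) (connEvent (row 36 n (a, b, c, y)).1) (connEvent (row 36 n (a, b, c, y)).2.1)
      (connEvent (row 36 n (a, b, c, y)).2.2) := by
  rw [← sahiE3_row36_swap]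
  rw [← sahiE3_row36_swap] at h36
  exact sahiE3_row36_nonneg_of_threeOneCut_a w b a y c h side ha hy hc hb hw h36

/-- **Lone leaf `y`** (`{a,b,c} | {y}`): row 36 at `(a,b,c,h)` ⟹ row 36 at `(a,b,c,y)`. [this work] -/
theorem sahiE3_row36_nonneg_of_threeOneCut_y (w : Sym2 (Fin n) → unitInterval) (a b c y h : Fin n) (side : Fin n → Bool)
    (ha : side a = true) (hb : side b = true) (hc : side c = true) (hy : side y = false)
    (hw : ∀ u v : Fin n, u ≠ h → v ≠ h → side u ≠ side v → w s(u, v) = 0)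
    (h36 : 0 ≤ sahiE3 (prodBernoulli w) (connEvent (row 36 n (a, b, c, h)).1) (connEvent (row 36 n (a, b, c, h)).2.1)
      (connEvent (row 36 n (a, b, c, h)).2.2)) :
    0 ≤ sahiE3 (prodBernoulli w) (connEvent (row 36 n (a, b, c, y)).1) (connEvent (row 36 n (a, b, c, y)).2.1)
      (connEvent (row 36 n (a, b, c, y)).2.2) := by
  rw [← sahiE3_row36_swap]
  rw [← sahiE3_row36_swap] at h36
  exact sahiE3_row36_nonneg_of_threeOneCut_c w b a y c h side hb ha hc hy hw h36

end Summit.CriticalPhenomena.PercolationContinuityZ3.Theorems.FrontierDecRows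

end
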